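import Summits.Parity.BatemanHorn.Theorems.SoloBlindSimpleImpostor
import HarnessLib

/-!
# Solo-blind kernel: prime-free `[0,2]`-valued sequences beyond the square-root level (Theorem 8.7 skeleton)

Sharpest-statement programme `solo-Parity-blind`, §8.7 of the paper.  For a window `W` of primes in
`(x^{a₀}, x^{τ}]` put `u(n) = ∑_{p ∈ W, p ∣ n} log p / log x` and, for a polynomial `ψ` with `ψ(0) = 0`,
`0 ≤ ψ ≤ 2` on `[a₀, 1]` and normalised mean, `a_n = 1 + λ(n)(1 − ψ(u(n)))`.  Theorem 8.7 of the paper says: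
`a` is `[0,2]`-valued, vanishes at primes, has PLAIN level of distribution `1 − (deg ψ)τ` (beyond `1/2`) and its
Liouville/Möbius twists are equidistributed in the classes `d ∣ n` up to level `a₀`; so no lower-bound sieve fed
by `R(ν)` with `ν > 1/2` plus a Hooley-type axiom of level `< a₀ ≍ (1 − ν)²` can produce primes.

This file is the finite, analysis-free skeleton: the shape `beyond F = 1 + λ(1 − F)` (prime-vanishing, range,
plain and twisted class sums in terms of those of `F`), exact class sums of divisibility indicators (floor counts;
bare Liouville sums), the window mass `u` with the spectral bound `u(n) ≤ 1` for `n ≤ x`, and the quadratic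
witness `1 + λ(n)(1 − c·u(n)(1 − u(n)))`, `0 ≤ c ≤ 8`: prime-free, `[0,2]`-valued, with plain and twisted class
sums at moduli coprime to the window reduced to floor counts and Liouville sums over `(a/(md), b/(md)]`,
`m ∈ {1, p, pq}`.  The analytic inputs (PNT for `λ` on those ranges; the Mertens-type evaluation of `c = 1/m_x < 8`
for `τ − a₀ − (τ² − a₀²)/2 − (τ − a₀)² > 1/8`) are not formalised here.
-/

open Finset
open ArithmeticFunction
open scoped ArithmeticFunction.Omega

namespace Summit.Parity.BatemanHorn.Theorems.SoloBlindBeyondHalf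

open Summit.Parity.BatemanHorn.Theorems.SoloBlindSimpleImpostor

/-- Bare Liouville class sum, stated right-to-left (local copy, kept private so that the tree's
`SoloBlindAntiDiagonal.lam_class_sum` remains the canonical declaration):
`λ(d) · ∑_{a/d<k≤b/d} λ(k) = ∑_{a<n≤b, d∣n} λ(n)`. -/
private theorem lam_class_sum_rev {a b d : ℕ} (hd : 0 < d) :
    lam d * ∑ k ∈ Ioc (a / d) (b / d), lam k = ∑ n ∈ (Ioc a b).filter (d ∣ ·), lam n := by
  rw [sum_filter_dvd_Ioc hd, Finset.mul_sum]
  refine Finset.sum_congr rfl fun k hk => ?_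
  rw [mem_Ioc] at hk
  have hk0 : k ≠ 0 := by
    intro h
    rw [h] at hk
    exact Nat.not_lt_zero _ hk.1
  rw [lam_mul hd.ne' hk0]

variable {a b d n p q : ℕ}

/-! ## Beyond the square root: the finite skeleton of Theorem 8.7

`a_n = 1 + λ(n)(1 − F(n))` with `F = ψ(u(n))`, `u(n) = ∑_{p ∈ W, p ∣ n} log p / log x`.  Here: the shape
`beyond F`, its vanishing at primes and its range; its plain and twisted class sums in terms of those of `F`
and `λF`; exact class sums of divisibility indicators (plain: floor counts; twisted: bare Liouville sums);
the mass `u` (`mass`), its vanishing at primes and the spectral bound `u(n) ≤ log n / log x ≤ 1`; and the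
quadratic witness `1 + λ(1 − c·u(1−u))`, `0 ≤ c ≤ 8`: prime-free, `[0,2]`-valued, with its class sums reduced
to floor counts and Liouville sums over the moduli `pd`, `pqd`.  The analytic inputs of Theorem 8.7 (PNT for
`λ` on the cofactor intervals, Mertens-type evaluation of the normalising constant) are NOT formalised. -/

/-- The shape of Theorem 8.7: `beyond F n = 1 + λ(n)·(1 − F n)` for a real statistic `F`. -/
def beyond (F : ℕ → ℝ) (n : ℕ) : ℝ := 1 + lam n * (1 - F n)

/-- `beyond F` vanishes at every prime at which the statistic vanishes. -/
theorem beyond_prime (F : ℕ → ℝ) (hp : p.Prime) (hF : F p = 0) : beyond F p = 0 := by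
  unfold beyond
  rw [lam_prime hp, hF]
  ring

/-- `beyond F n ∈ [0, 2]` whenever `F n ∈ [0, 2]` (since `|λ| = 1`). -/
theorem beyond_mem_Icc (F : ℕ → ℝ) (h0 : 0 ≤ F n) (h2 : F n ≤ 2) :
    beyond F n ∈ Set.Icc (0 : ℝ) 2 := by
  unfold beyond
  have h1 : |lam n * (1 - F n)| ≤ 1 := by
    rw [abs_mul, abs_lam, one_mul, abs_le]
    constructor <;> linarith
  rw [abs_le] at h1
  rw [Set.mem_Icc]
  constructor <;> linarith [h1.1, h1.2]

/-- `λ(n)² = 1`. -/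
theorem lam_mul_self (n : ℕ) : lam n * lam n = 1 := by
  unfold lam
  rw [← pow_add, ← two_mul, pow_mul]
  norm_num

/-- PLAIN class sum of `beyond F`:
`∑_{d∣n} beyond F = #{a<n≤b : d∣n} + λ(d)∑_{a/d<k≤b/d} λ(k) − ∑_{d∣n} λ(n) F(n)`. -/
theorem beyond_class_sum (F : ℕ → ℝ) (hd : 0 < d) :
    ∑ n ∈ (Ioc a b).filter (d ∣ ·), beyond F n
      = (#((Ioc a b).filter (d ∣ ·)) : ℝ) + lam d * ∑ k ∈ Ioc (a / d) (b / d), lam k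
        - ∑ n ∈ (Ioc a b).filter (d ∣ ·), lam n * F n := by
  have hpt : ∀ n, beyond F n = 1 + (lam n - lam n * F n) := by
    intro n
    unfold beyond
    ring
  simp_rw [hpt]
  rw [Finset.sum_add_distrib, Finset.sum_const, nsmul_eq_mul, mul_one, Finset.sum_sub_distrib,
    ← lam_class_sum_rev hd]
  ring

/-- TWISTED class sum of `beyond F` (using `λ² = 1`):
`∑_{d∣n} λ(n)·beyond F = λ(d)∑_{a/d<k≤b/d} λ(k) + #{a<n≤b : d∣n} − ∑_{d∣n} F(n)`. -/
theorem beyond_class_sum_twisted (F : ℕ → ℝ) (hd : 0 < d) :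
    ∑ n ∈ (Ioc a b).filter (d ∣ ·), lam n * beyond F n
      = lam d * ∑ k ∈ Ioc (a / d) (b / d), lam k + (#((Ioc a b).filter (d ∣ ·)) : ℝ)
        - ∑ n ∈ (Ioc a b).filter (d ∣ ·), F n := by
  have hpt : ∀ n, lam n * beyond F n = lam n + (1 - F n) := by
    intro n
    unfold beyond
    have h := lam_mul_self n
    calc lam n * (1 + lam n * (1 - F n)) = lam n + lam n * lam n * (1 - F n) := by ring
      _ = lam n + (1 - F n) := by rw [h]; ring
  simp_rw [hpt]
  rw [Finset.sum_add_distrib, ← lam_class_sum_rev hd, Finset.sum_sub_distrib, Finset.sum_const,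
    nsmul_eq_mul, mul_one]
  ring

/-! ### Exact class sums of divisibility indicators -/

/-- Plain class sum of the indicator of `q ∣ n` at a modulus `d` coprime to `q`: the floor count
`⌊b/(qd)⌋ − ⌊a/(qd)⌋`. -/
theorem ind_class_sum (hd : 0 < d) (hq : 0 < q) (hcop : Nat.Coprime q d) :
    ∑ n ∈ (Ioc a b).filter (d ∣ ·), (if q ∣ n then (1 : ℝ) else 0)
      = ((b / (q * d) - a / (q * d) : ℕ) : ℝ) := by
  rw [Finset.sum_boole, filter_dvd_and_dvd hcop, card_filter_dvd_Ioc (Nat.mul_pos hq hd)]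

/-- Twisted class sum of the indicator of `q ∣ n` at a modulus `d` coprime to `q`: the bare Liouville
sum `λ(qd)·∑_{a/(qd)<k≤b/(qd)} λ(k)`. -/
theorem ind_class_sum_twisted (hd : 0 < d) (hq : 0 < q) (hcop : Nat.Coprime q d) :
    ∑ n ∈ (Ioc a b).filter (d ∣ ·), lam n * (if q ∣ n then (1 : ℝ) else 0)
      = lam (q * d) * ∑ k ∈ Ioc (a / (q * d)) (b / (q * d)), lam k := by
  have h : ∀ n, lam n * (if q ∣ n then (1 : ℝ) else 0) = if q ∣ n then lam n else 0 := by
    intro n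
    split_ifs <;> simp
  simp_rw [h]
  rw [← Finset.sum_filter, filter_dvd_and_dvd hcop, ← lam_class_sum_rev (Nat.mul_pos hq hd)]

/-- Twisted class sum of the indicator of `q ∣ n` at a modulus `d` DIVISIBLE by `q`: the indicator is
identically `1` on the class, so the sum is the bare Liouville sum of the class. -/
theorem ind_class_sum_twisted_of_dvd (hd : 0 < d) (hqd : q ∣ d) :
    ∑ n ∈ (Ioc a b).filter (d ∣ ·), lam n * (if q ∣ n then (1 : ℝ) else 0)
      = lam d * ∑ k ∈ Ioc (a / d) (b / d), lam k := by
  rw [lam_class_sum_rev hd]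
  refine Finset.sum_congr rfl fun n hn => ?_
  rw [mem_filter] at hn
  rw [if_pos (hqd.trans hn.2), mul_one]

/-! ### The logarithmic mass of a window and its spectral bound -/

/-- Weighted prime mass of `n` from the window `W`: `mass W w n = ∑_{p ∈ W, p ∣ n} w p`
(Theorem 8.7 takes `w p = log p / log x`). -/
def mass (W : Finset ℕ) (w : ℕ → ℝ) (n : ℕ) : ℝ := ∑ p ∈ W.filter (· ∣ n), w p

/-- `mass` as a sum of indicators over the whole window. -/
theorem mass_eq_sum_ite (W : Finset ℕ) (w : ℕ → ℝ) (n : ℕ) :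
    mass W w n = ∑ p ∈ W, if p ∣ n then w p else 0 := by
  unfold mass
  rw [Finset.sum_filter]

/-- The mass vanishes at a prime `p` not lying in the window (and `1 ∉ W`). -/
theorem mass_prime_eq_zero {W : Finset ℕ} (w : ℕ → ℝ) (hp : p.Prime) (hW : ∀ q ∈ W, q ≠ 1 ∧ q ≠ p) :
    mass W w p = 0 := by
  rw [mass_eq_sum_ite]
  refine Finset.sum_eq_zero fun q hq => ?_
  rw [if_neg]
  intro hqp
  rcases (Nat.dvd_prime hp).mp hqp with h | h
  · exact (hW q hq).1 h
  · exact (hW q hq).2 h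

/-- The mass is nonnegative for nonnegative weights. -/
theorem mass_nonneg {W : Finset ℕ} {w : ℕ → ℝ} (hw : ∀ p ∈ W, 0 ≤ w p) : 0 ≤ mass W w n :=
  Finset.sum_nonneg fun p hp => hw p (mem_filter.mp hp).1

/-- THE SPECTRAL BOUND: for a window of primes and logarithmic weights, `u(n) ≤ log n / log x ≤ 1`
whenever `1 ≤ n ≤ x` (the primes of `W` dividing `n` have product dividing `n`). -/
theorem mass_log_le_one {W : Finset ℕ} {x : ℝ} (hW : ∀ p ∈ W, p.Prime) (hn : 0 < n) (hx : 1 < x)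
    (hnx : (n : ℝ) ≤ x) :
    mass W (fun p => Real.log p / Real.log x) n ≤ 1 := by
  unfold mass
  set T := W.filter (· ∣ n) with hT
  have hTp : ∀ p ∈ T, p.Prime := fun p hp => hW p (mem_filter.mp hp).1
  have hTd : ∀ p ∈ T, p ∣ n := fun p hp => (mem_filter.mp hp).2
  have hprod : ∏ p ∈ T, p ∣ n := Finset.prod_primes_dvd n (fun p hp => (hTp p hp).prime) hTd
  have hle : ((∏ p ∈ T, p : ℕ) : ℝ) ≤ n := by exact_mod_cast Nat.le_of_dvd hn hprod
  push_cast at hle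
  have hpos : ∀ p ∈ T, (0 : ℝ) < p := fun p hp => by exact_mod_cast (hTp p hp).pos
  have hlogx : 0 < Real.log x := Real.log_pos hx
  have hsum : ∑ p ∈ T, (fun p : ℕ => Real.log p / Real.log x) p
      = (∑ p ∈ T, Real.log p) * (Real.log x)⁻¹ := by
    rw [Finset.sum_mul]
    refine Finset.sum_congr rfl fun p _ => ?_
    simp only [div_eq_mul_inv]
  rw [hsum, ← div_eq_mul_inv, div_le_one hlogx]
  calc ∑ p ∈ T, Real.log p = Real.log (∏ p ∈ T, (p : ℝ)) := by
          rw [Real.log_prod]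
          intro p hp; exact (hpos p hp).ne'
    _ ≤ Real.log n := Real.log_le_log (Finset.prod_pos hpos) hle
    _ ≤ Real.log x := Real.log_le_log (by exact_mod_cast hn) hnx

/-! ### The quadratic witness `1 + λ(n)(1 − c·u(n)(1 − u(n)))`, `0 ≤ c ≤ 8` -/

/-- `0 ≤ u(1−u) ≤ 1/4` on `[0,1]`. -/
theorem quad_mem {u : ℝ} (h0 : 0 ≤ u) (h1 : u ≤ 1) : 0 ≤ u * (1 - u) ∧ u * (1 - u) ≤ 1 / 4 := by
  constructor
  · exact mul_nonneg h0 (by linarith)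
  · nlinarith [sq_nonneg (u - 1 / 2)]

/-- `0 ≤ c·u(1−u) ≤ 2` on `[0,1]` for `0 ≤ c ≤ 8`. -/
theorem quad_scaled_mem {c u : ℝ} (hc0 : 0 ≤ c) (hc8 : c ≤ 8) (h0 : 0 ≤ u) (h1 : u ≤ 1) :
    0 ≤ c * (u * (1 - u)) ∧ c * (u * (1 - u)) ≤ 2 := by
  obtain ⟨hq0, hq⟩ := quad_mem h0 h1
  exact ⟨mul_nonneg hc0 hq0, by nlinarith⟩

/-- The quadratic statistic `c·u(n)(1 − u(n))`. -/
def quadStat (W : Finset ℕ) (w : ℕ → ℝ) (c : ℝ) (n : ℕ) : ℝ := c * (mass W w n * (1 - mass W w n))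

/-- The quadratic witness of Theorem 8.7: `1 + λ(n)·(1 − c·u(n)(1 − u(n)))`. -/
def quadWitness (W : Finset ℕ) (w : ℕ → ℝ) (c : ℝ) : ℕ → ℝ := beyond (quadStat W w c)

/-- The quadratic witness vanishes at every prime outside the window. -/
theorem quadWitness_prime {W : Finset ℕ} {w : ℕ → ℝ} {c : ℝ} (hp : p.Prime)
    (hW : ∀ q ∈ W, q ≠ 1 ∧ q ≠ p) : quadWitness W w c p = 0 := by
  apply beyond_prime _ hp
  unfold quadStat
  rw [mass_prime_eq_zero w hp hW]
  ring

/-- The quadratic witness takes values in `[0, 2]` on `1 ≤ n ≤ x` when `W` consists of primes, the weights are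
`log p / log x`, and `0 ≤ c ≤ 8` (Theorem 8.7 has `c = 1/m_x < 8`). -/
theorem quadWitness_mem_Icc {W : Finset ℕ} {c x : ℝ} (hW : ∀ p ∈ W, p.Prime) (hn : 0 < n) (hx : 1 < x)
    (hnx : (n : ℝ) ≤ x) (hc0 : 0 ≤ c) (hc8 : c ≤ 8) :
    quadWitness W (fun p => Real.log p / Real.log x) c n ∈ Set.Icc (0 : ℝ) 2 := by
  have hu1 := mass_log_le_one hW hn hx hnx
  have hu0 : 0 ≤ mass W (fun p => Real.log p / Real.log x) n := by
    refine mass_nonneg fun p hp => div_nonneg (Real.log_nonneg ?_) (Real.log_nonneg hx.le)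
    exact_mod_cast (hW p hp).one_lt.le
  obtain ⟨h0, h2⟩ := quad_scaled_mem hc0 hc8 hu0 hu1
  exact beyond_mem_Icc _ h0 h2

/-! ### Class sums of the quadratic statistic: reduction to the moduli `pd` and `pqd` -/

/-- The modulus attached to a pair of window primes: `p` on the diagonal, `pq` off it. -/
def pairMod (p q : ℕ) : ℕ := if p = q then p else p * q

/-- For primes `p, q`: `p ∣ n ∧ q ∣ n ↔ pairMod p q ∣ n`. -/
theorem and_dvd_iff_pairMod_dvd (hp : p.Prime) (hq : q.Prime) : (p ∣ n ∧ q ∣ n) ↔ pairMod p q ∣ n := by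
  unfold pairMod
  split_ifs with h
  · subst h
    exact ⟨fun h => h.1, fun h => ⟨h, h⟩⟩
  · constructor
    · rintro ⟨h1, h2⟩
      exact ((Nat.coprime_primes hp hq).mpr h).mul_dvd_of_dvd_of_dvd h1 h2
    · intro hh
      exact ⟨(dvd_mul_right p q).trans hh, (dvd_mul_left q p).trans hh⟩

/-- `pairMod p q` is positive and coprime to `d` when `p, q` are primes coprime to `d`. -/
theorem pairMod_pos_coprime (hp : p.Prime) (hq : q.Prime) (hpd : Nat.Coprime p d) (hqd : Nat.Coprime q d) :
    0 < pairMod p q ∧ Nat.Coprime (pairMod p q) d := by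
  unfold pairMod
  split_ifs with h
  · exact ⟨hp.pos, hpd⟩
  · exact ⟨Nat.mul_pos hp.pos hq.pos, Nat.Coprime.mul_left hpd hqd⟩

/-- Expansion of `u(1 − u)` into single and pair indicators. -/
theorem quadStat_eq (W : Finset ℕ) (w : ℕ → ℝ) (c : ℝ) (n : ℕ) :
    quadStat W w c n = c * (∑ p ∈ W, (if p ∣ n then w p else 0))
      - c * ∑ p ∈ W, ∑ q ∈ W, (if p ∣ n ∧ q ∣ n then w p * w q else 0) := by
  unfold quadStat
  rw [mass_eq_sum_ite, mul_sub, mul_one, Finset.sum_mul_sum, mul_sub]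
  congr 2
  refine Finset.sum_congr rfl fun p _ => Finset.sum_congr rfl fun q _ => ?_
  by_cases h1 : p ∣ n <;> by_cases h2 : q ∣ n <;> simp [h1, h2]

/-- EXACT PLAIN CLASS SUM of the quadratic statistic at a modulus `d` coprime to the (prime) window:
`∑_{d∣n} c·u(1−u) = c∑_{p∈W} w_p N(pd) − c∑_{p,q∈W} w_p w_q N(pairMod(p,q)·d)`, `N(m) := ⌊b/m⌋ − ⌊a/m⌋`. -/
theorem quadStat_class_sum {W : Finset ℕ} {w : ℕ → ℝ} {c : ℝ} (hd : 0 < d)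
    (hW : ∀ p ∈ W, p.Prime ∧ Nat.Coprime p d) :
    ∑ n ∈ (Ioc a b).filter (d ∣ ·), quadStat W w c n
      = c * ∑ p ∈ W, w p * ((b / (p * d) - a / (p * d) : ℕ) : ℝ)
        - c * ∑ p ∈ W, ∑ q ∈ W,
            w p * w q * ((b / (pairMod p q * d) - a / (pairMod p q * d) : ℕ) : ℝ) := by
  simp_rw [quadStat_eq]
  rw [Finset.sum_sub_distrib, ← Finset.mul_sum, ← Finset.mul_sum]
  congr 2
  · rw [Finset.sum_comm]
    refine Finset.sum_congr rfl fun p hp => ?_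
    obtain ⟨hpp, hcop⟩ := hW p hp
    have h : ∀ n, (if p ∣ n then w p else 0) = w p * (if p ∣ n then (1 : ℝ) else 0) := by
      intro n
      split_ifs <;> simp
    simp_rw [h]
    rw [← Finset.mul_sum, ind_class_sum hd hpp.pos hcop]
  · rw [Finset.sum_comm]
    refine Finset.sum_congr rfl fun p hp => ?_
    rw [Finset.sum_comm]
    refine Finset.sum_congr rfl fun q hq => ?_
    obtain ⟨hpp, hpd⟩ := hW p hp
    obtain ⟨hqq, hqd⟩ := hW q hq
    obtain ⟨hm0, hmc⟩ := pairMod_pos_coprime hpp hqq hpd hqd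
    have h : ∀ n, (if p ∣ n ∧ q ∣ n then w p * w q else 0)
        = w p * w q * (if pairMod p q ∣ n then (1 : ℝ) else 0) := by
      intro n
      by_cases hc : pairMod p q ∣ n
      · rw [if_pos hc, if_pos ((and_dvd_iff_pairMod_dvd hpp hqq).mpr hc), mul_one]
      · rw [if_neg hc, if_neg (fun h' => hc ((and_dvd_iff_pairMod_dvd hpp hqq).mp h')), mul_zero]
    simp_rw [h]
    rw [← Finset.mul_sum, ind_class_sum hd hm0 hmc]

/-- EXACT TWISTED CLASS SUM of the quadratic statistic at a modulus `d` coprime to the (prime) window: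
`∑_{d∣n} λ(n)·c·u(1−u) = c∑_p w_p λ(pd) L(pd) − c∑_{p,q} w_p w_q λ(m d) L(m d)`, `m = pairMod(p,q)`,
`L(m) := ∑_{a/m<k≤b/m} λ(k)` — bare Liouville sums only. -/
theorem quadStat_class_sum_twisted {W : Finset ℕ} {w : ℕ → ℝ} {c : ℝ} (hd : 0 < d)
    (hW : ∀ p ∈ W, p.Prime ∧ Nat.Coprime p d) :
    ∑ n ∈ (Ioc a b).filter (d ∣ ·), lam n * quadStat W w c n
      = c * ∑ p ∈ W, w p * (lam (p * d) * ∑ k ∈ Ioc (a / (p * d)) (b / (p * d)), lam k)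
        - c * ∑ p ∈ W, ∑ q ∈ W, w p * w q *
            (lam (pairMod p q * d) * ∑ k ∈ Ioc (a / (pairMod p q * d)) (b / (pairMod p q * d)), lam k) := by
  have hpt : ∀ n, lam n * quadStat W w c n
      = c * ∑ p ∈ W, w p * (lam n * (if p ∣ n then (1 : ℝ) else 0))
        - c * ∑ p ∈ W, ∑ q ∈ W, w p * w q * (lam n * (if p ∣ n ∧ q ∣ n then (1 : ℝ) else 0)) := by
    intro n
    rw [quadStat_eq, mul_sub]
    simp only [Finset.mul_sum]
    congr 1
    · refine Finset.sum_congr rfl fun p _ => ?_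
      split_ifs <;> ring
    · refine Finset.sum_congr rfl fun p _ => ?_
      refine Finset.sum_congr rfl fun q _ => ?_
      split_ifs <;> ring
  simp_rw [hpt]
  rw [Finset.sum_sub_distrib, ← Finset.mul_sum, ← Finset.mul_sum]
  congr 2
  · rw [Finset.sum_comm]
    refine Finset.sum_congr rfl fun p hp => ?_
    obtain ⟨hpp, hcop⟩ := hW p hp
    rw [← Finset.mul_sum, ind_class_sum_twisted hd hpp.pos hcop]
  · rw [Finset.sum_comm]
    refine Finset.sum_congr rfl fun p hp => ?_
    rw [Finset.sum_comm]
    refine Finset.sum_congr rfl fun q hq => ?_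
    obtain ⟨hpp, hpd⟩ := hW p hp
    obtain ⟨hqq, hqd⟩ := hW q hq
    obtain ⟨hm0, hmc⟩ := pairMod_pos_coprime hpp hqq hpd hqd
    have h : ∀ n, (lam n * if p ∣ n ∧ q ∣ n then (1 : ℝ) else 0)
        = lam n * (if pairMod p q ∣ n then (1 : ℝ) else 0) := by
      intro n
      by_cases hc : pairMod p q ∣ n
      · rw [if_pos hc, if_pos ((and_dvd_iff_pairMod_dvd hpp hqq).mpr hc)]
      · rw [if_neg hc, if_neg (fun h' => hc ((and_dvd_iff_pairMod_dvd hpp hqq).mp h'))]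
    simp_rw [h]
    rw [← Finset.mul_sum, ind_class_sum_twisted hd hm0 hmc]

/-- PLAIN class sum of the quadratic WITNESS: floor count `+ λ(d)L(d) −` (twisted class sum of the statistic,
i.e. Liouville sums over the cofactor ranges `(a/(md), b/(md)]`, `m = p` or `pairMod(p,q)`). -/
theorem quadWitness_class_sum {W : Finset ℕ} {w : ℕ → ℝ} {c : ℝ} (hd : 0 < d)
    (hW : ∀ p ∈ W, p.Prime ∧ Nat.Coprime p d) :
    ∑ n ∈ (Ioc a b).filter (d ∣ ·), quadWitness W w c n
      = (#((Ioc a b).filter (d ∣ ·)) : ℝ) + lam d * ∑ k ∈ Ioc (a / d) (b / d), lam k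
        - (c * ∑ p ∈ W, w p * (lam (p * d) * ∑ k ∈ Ioc (a / (p * d)) (b / (p * d)), lam k)
          - c * ∑ p ∈ W, ∑ q ∈ W, w p * w q *
            (lam (pairMod p q * d) * ∑ k ∈ Ioc (a / (pairMod p q * d)) (b / (pairMod p q * d)), lam k)) := by
  unfold quadWitness
  rw [beyond_class_sum _ hd, quadStat_class_sum_twisted hd hW]

/-- TWISTED class sum of the quadratic WITNESS at a modulus coprime to the window:
`λ(d)L(d) + ⌊b/d⌋ − ⌊a/d⌋ − c(∑_p w_p N(pd) − ∑_{p,q} w_p w_q N(pairMod(p,q)d))` — floor counts and one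
Liouville sum; in Theorem 8.7 the floor counts add up to `(|I|/d)(1 − M_x(ψ)) + O(#W²) = O(#W²)`. -/
theorem quadWitness_class_sum_twisted {W : Finset ℕ} {w : ℕ → ℝ} {c : ℝ} (hd : 0 < d)
    (hW : ∀ p ∈ W, p.Prime ∧ Nat.Coprime p d) :
    ∑ n ∈ (Ioc a b).filter (d ∣ ·), lam n * quadWitness W w c n
      = lam d * ∑ k ∈ Ioc (a / d) (b / d), lam k + (#((Ioc a b).filter (d ∣ ·)) : ℝ)
        - (c * ∑ p ∈ W, w p * ((b / (p * d) - a / (p * d) : ℕ) : ℝ)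
          - c * ∑ p ∈ W, ∑ q ∈ W,
            w p * w q * ((b / (pairMod p q * d) - a / (pairMod p q * d) : ℕ) : ℝ)) := by
  unfold quadWitness
  rw [beyond_class_sum_twisted _ hd, quadStat_class_sum hd hW]

end Summit.Parity.BatemanHorn.Theorems.SoloBlindBeyondHalf
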